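import Summits.BirchSwinnertonDyer.Rank1Residual.Additive.SemistableTwistRankZeroThreeClassOfPrime
import Summits.BirchSwinnertonDyer.Rank1Residual.Additive.X3SemistableTwistRankZeroThreeClassNoMilne
import Summits.BirchSwinnertonDyer.Rank1Residual.Additive.X4SemistableTwistRankZeroThreeClassNoMilne
import HarnessLib

/-!
# X3 / X4 ∧ semistable twist at `p = 3`, ranks `(0,0)`: the prime-indexed class theorems over `K = ℚ(ζ₃)` — Milne's A73 PROVED AWAY
# (cell `b2b-bsdres`, team n1011, seat p16 GEN 11; lead R5-87 (e) (W2) = additive-p4 GEN 23 word: the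
# UPPER / two-sided no-Milne twins of the additive-p4 ℚ(ζ₃) lines are the p16 lineage's; row T-MIL-CAN)

HONEST FRAMING (cell `b2b-bsdres`, run/shared/lean/b2b/bsd-rank1-residual/, verbatim in every
file): the goal of the cell is to DELETE the COMBINATION-SHAPED residual classes of the
Birch–Swinnerton-Dyer formula for ALL analytic-rank `≤ 1` elliptic curves over `ℚ` — "full BSD
formula for every rank `≤ 1` curve in class `C`" assembled STRICTLY from published theorems — so
that the rank-`≤ 1` remainder becomes exactly the CONSTRUCTION-SHAPED classes, which are TYPED
(missing-input `Prop`s), NOT attempted. This is not "finishing BSD". Team n1011 (N10 / N11), seat p16: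
research route; X1 / X3 / X4 / X10 / N10 / N11 labels and marks UNCHANGED; nothing booked. Theorems only.

This file is `SemistableTwistRankZeroThreeClassOfPrime.lean` (mathematics, census and references in THAT file's docstrings,
unchanged) with the Milne binder `hMilne : Milne1972.bsdQuotient_baseChange_quadratic_anyModel` (A73)
DELETED from every Milne-binding theorem and NOTHING added: each such theorem is re-issued under its name
with the suffix `_noMilne`, every other binder and every proof line byte-identical, every call to a
Milne-binding tree theorem redirected to its no-Milne twin (`…_noLocal` cores / `…_noMilne` Facts of the
p16 lineage); Milne-free helpers of the source file are used as landed, not re-declared. What the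
additive-p4 cores read from A73 — `Ш(V_K)` finite and the `3`-adic valuation of the card identity over
`K = ℚ(ζ₃)` — are the THEOREMS `shaFinite_baseChange_of_twist` and T-MIL-CAN FILE 4
`padicVal_card_identity_baseChange[_anyRank]_of_natAbs_discr_eq` (`|d_K| = 3`, `V` good or multiplicative
at `3`: the per-place fibre identities (T) at EVERY place — n1011-p01's T-MIL-3 H-5a with rows T-MIL-B2 /
T-A233 inside). Every other displayed hypothesis (named facts, (⊇/K) where present, census bits,
certificates) is exactly the source file's. Labels UNCHANGED; nothing booked; no mark moves.
-/

noncomputable section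

open scoped Classical

open WeierstrassCurve Literature.NumberTheory.EllipticCurves
  Literature.NumberTheory.EllipticCurves.ModularForms
  Literature.NumberTheory.EllipticCurves.Rank1Residual
  Literature.NumberTheory.EllipticCurves.Rank1Residual.Typed
  Summit.BirchSwinnertonDyer.Rank1Residual.AdditivePotMult

namespace Summit.BirchSwinnertonDyer.Rank1Residual.Additive

variable (V : WeierstrassCurve ℚ) [V.IsElliptic] [V.IsGloballyMinimal]
  (W : WeierstrassCurve ℚ) [W.IsElliptic] [W.IsGloballyMinimal]

/-! ### X3 (reducible `W[3]`): Wuthrich Thm. 16 readings at a general odd `p` -/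

/-- **X3 at `p = 3`, class level, ranks `(0,0)`, semistable twist: the sum inequality
`ord₃ #Ш(V) + ord₃ #Ш(W) ≤ ord₃ #Ш_an(V) + ord₃ #Ш_an(W)`** — `ClassX3.exists_padicVal_shaOrder_add_le_three_of_semistableTwist_noMilne`
with the three Wuthrich Thm. 16 readings taken at a GENERAL odd `p` over `ℚ(ζ_p)` (A117, A126, A127)
and specialised to `p = 3` by the kernel bridges of gen 11.
[cite: Wuthrich2014, Thm. 16 (p. 397)] [cite: GreenbergLNM1716, Thm. 4.1 (p. 102) and §4 pp. 112–113]
[cite: Milne1972ArithmeticAV, §1 Thm. 1 and §2 (through DokchitserDokchitserAnnals2010, §2.1, proof of Thm. 8)] -/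
theorem ClassX3.exists_padicVal_shaOrder_add_le_three_of_semistableTwist_of_primeFacts_noMilne
    (hW : Wuthrich2014.charIdeal_dvd_padicLFunction_cyclotomicPrime)
    (hWns : Wuthrich2014.thm16_charIdeal_dvd_nonsplitMultiplicative_cyclotomicPrime)
    (hWs : Wuthrich2014.thm16_charIdeal_dvd_splitMultiplicative_cyclotomicPrime)
    (hGr : Greenberg1999.thm41_charValue_rankZero_numberField)
    (hGrns : Greenberg1999.thm41Analogue_charValue_rankZero_numberField)
    (hGrs : Greenberg1999.thm41Analogue_charValue_rankZero_split_baseChange)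
    (hGS : greenberg_stevens V 3)
    (hGZK : rank_eq_analyticRank_of_analyticRank_le_one) (hmod : hasEntireLFunction_rat)
    (hmodD : nonempty_modularParametrizationData)
    (hX : ClassX3 W 3) (C : VariableChange ℚ) (hC : C • V.quadraticTwist (-(3 : ℚ)) = W)
    (hsst : V.HasGoodReductionAtPrime 3 ∨ V.HasMultiplicativeReductionAtPrime 3)
    (hrV : V.analyticRank = 0) (hrW : W.analyticRank = 0) :
    ∃ qV qW : ℚ, shaAn V = (qV : ℂ) ∧ shaAn W = (qW : ℂ) ∧
      (padicValNat 3 V.shaOrder : ℤ) + padicValNat 3 W.shaOrder ≤ padicValRat 3 qV + padicValRat 3 qW :=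
  ClassX3.exists_padicVal_shaOrder_add_le_three_of_semistableTwist_noMilne V W
    (Wuthrich2014.charIdeal_dvd_padicLFunction_cyclotomicThree_of_cyclotomicPrime hW)
    (Wuthrich2014.thm16_charIdeal_dvd_nonsplitMultiplicative_cyclotomicThree_of_cyclotomicPrime hWns)
    (Wuthrich2014.thm16_charIdeal_dvd_splitMultiplicative_cyclotomicThree_of_cyclotomicPrime hWs)
    hGr hGrns hGrs hGS hGZK hmod hmodD hX C hC hsst hrV hrW

/-- **X3 at `p = 3`, class level: the typed UPPER half `Typed.MissingUpperBoundAt W 3`** on the rows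
with `3 ∤ #Ш_an(V)` — `ClassX3.missingUpperBoundAt_three_of_semistableTwist_noMilne` re-based on the odd-`p`
Wuthrich readings (A117, A126, A127).
[cite: Wuthrich2014, Thm. 16 (p. 397)] [cite: GreenbergLNM1716, Thm. 4.1 (p. 102) and §4 pp. 112–113] -/
theorem ClassX3.missingUpperBoundAt_three_of_semistableTwist_of_primeFacts_noMilne
    (hW : Wuthrich2014.charIdeal_dvd_padicLFunction_cyclotomicPrime)
    (hWns : Wuthrich2014.thm16_charIdeal_dvd_nonsplitMultiplicative_cyclotomicPrime)
    (hWs : Wuthrich2014.thm16_charIdeal_dvd_splitMultiplicative_cyclotomicPrime)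
    (hGr : Greenberg1999.thm41_charValue_rankZero_numberField)
    (hGrns : Greenberg1999.thm41Analogue_charValue_rankZero_numberField)
    (hGrs : Greenberg1999.thm41Analogue_charValue_rankZero_split_baseChange)
    (hGS : greenberg_stevens V 3)
    (hGZK : rank_eq_analyticRank_of_analyticRank_le_one) (hmod : hasEntireLFunction_rat)
    (hmodD : nonempty_modularParametrizationData)
    (hX : ClassX3 W 3) (C : VariableChange ℚ) (hC : C • V.quadraticTwist (-(3 : ℚ)) = W)
    (hsst : V.HasGoodReductionAtPrime 3 ∨ V.HasMultiplicativeReductionAtPrime 3)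
    (hrV : V.analyticRank = 0) (hrW : W.analyticRank = 0)
    {qV : ℚ} (hqV : shaAn V = (qV : ℂ)) (hv : padicValRat 3 qV ≤ 0) :
    MissingUpperBoundAt W 3 :=
  ClassX3.missingUpperBoundAt_three_of_semistableTwist_noMilne V W
    (Wuthrich2014.charIdeal_dvd_padicLFunction_cyclotomicThree_of_cyclotomicPrime hW)
    (Wuthrich2014.thm16_charIdeal_dvd_nonsplitMultiplicative_cyclotomicThree_of_cyclotomicPrime hWns)
    (Wuthrich2014.thm16_charIdeal_dvd_splitMultiplicative_cyclotomicThree_of_cyclotomicPrime hWs)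
    hGr hGrns hGrs hGS hGZK hmod hmodD hX C hC hsst hrV hrW hqV hv

/-- **X3 at `p = 3`, class level: `BSD(W,3) ∧ BSD(V,3)` on the doubly-unit rank-`(0,0)` rows** —
`ClassX3.bsdp_three_of_semistableTwist_of_shaAn_units_noMilne` re-based on the odd-`p` Wuthrich readings
(A117, A126, A127). Census unchanged (243 of the 247 CORE-open rows, hyp cyc3 two-engine, `N < 2·10⁴`).
Labels UNCHANGED; nothing booked.
[cite: Wuthrich2014, Thm. 16 (p. 397)] [cite: GreenbergLNM1716, Thm. 4.1 (p. 102) and §4 pp. 112–113]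
[cite: Milne1972ArithmeticAV, §1 Thm. 1 and §2 (through DokchitserDokchitserAnnals2010, §2.1, proof of Thm. 8)] [cite: Miller2011LMS, §1 and Def. 1.1] -/
theorem ClassX3.bsdp_three_of_semistableTwist_of_shaAn_units_of_primeFacts_noMilne
    (hW : Wuthrich2014.charIdeal_dvd_padicLFunction_cyclotomicPrime)
    (hWns : Wuthrich2014.thm16_charIdeal_dvd_nonsplitMultiplicative_cyclotomicPrime)
    (hWs : Wuthrich2014.thm16_charIdeal_dvd_splitMultiplicative_cyclotomicPrime)
    (hGr : Greenberg1999.thm41_charValue_rankZero_numberField)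
    (hGrns : Greenberg1999.thm41Analogue_charValue_rankZero_numberField)
    (hGrs : Greenberg1999.thm41Analogue_charValue_rankZero_split_baseChange)
    (hGS : greenberg_stevens V 3)
    (hGZK : rank_eq_analyticRank_of_analyticRank_le_one) (hmod : hasEntireLFunction_rat)
    (hmodD : nonempty_modularParametrizationData)
    (hX : ClassX3 W 3) (C : VariableChange ℚ) (hC : C • V.quadraticTwist (-(3 : ℚ)) = W)
    (hsst : V.HasGoodReductionAtPrime 3 ∨ V.HasMultiplicativeReductionAtPrime 3)
    (hrV : V.analyticRank = 0) (hrW : W.analyticRank = 0)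
    {qV qW : ℚ} (hqV : shaAn V = (qV : ℂ)) (hqW : shaAn W = (qW : ℂ))
    (hvV : padicValRat 3 qV = 0) (hvW : padicValRat 3 qW = 0) : BSDp W 3 ∧ BSDp V 3 :=
  ClassX3.bsdp_three_of_semistableTwist_of_shaAn_units_noMilne V W
    (Wuthrich2014.charIdeal_dvd_padicLFunction_cyclotomicThree_of_cyclotomicPrime hW)
    (Wuthrich2014.thm16_charIdeal_dvd_nonsplitMultiplicative_cyclotomicThree_of_cyclotomicPrime hWns)
    (Wuthrich2014.thm16_charIdeal_dvd_splitMultiplicative_cyclotomicThree_of_cyclotomicPrime hWs)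
    hGr hGrns hGrs hGS hGZK hmod hmodD hX C hC hsst hrV hrW hqV hqW hvV hvW

/-- **X3♯(M) at `p = 3`, ranks `(0,0)`: the sum inequality** — `ClassX3M.exists_padicVal_shaOrder_add_le_three_noMilne`
re-based on the odd-`p` multiplicative Wuthrich readings (A126, A127).
[cite: Wuthrich2014, Thm. 16 (p. 397)] [cite: GreenbergLNM1716, §4 pp. 112–113] [cite: SilvermanATAEC1994, V.5.3] -/
theorem ClassX3M.exists_padicVal_shaOrder_add_le_three_of_primeFacts_noMilne
    (hWns : Wuthrich2014.thm16_charIdeal_dvd_nonsplitMultiplicative_cyclotomicPrime)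
    (hWs : Wuthrich2014.thm16_charIdeal_dvd_splitMultiplicative_cyclotomicPrime)
    (hGrns : Greenberg1999.thm41Analogue_charValue_rankZero_numberField)
    (hGrs : Greenberg1999.thm41Analogue_charValue_rankZero_split_baseChange)
    (hGS : greenberg_stevens V 3)
    (hGZK : rank_eq_analyticRank_of_analyticRank_le_one) (hmod : hasEntireLFunction_rat)
    (hmodD : nonempty_modularParametrizationData)
    (hX : ClassX3M W 3) (C : VariableChange ℚ) (hC : C • V.quadraticTwist (-(3 : ℚ)) = W)
    (hrV : V.analyticRank = 0) (hrW : W.analyticRank = 0) :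
    ∃ qV qW : ℚ, shaAn V = (qV : ℂ) ∧ shaAn W = (qW : ℂ) ∧
      (padicValNat 3 V.shaOrder : ℤ) + padicValNat 3 W.shaOrder ≤ padicValRat 3 qV + padicValRat 3 qW :=
  ClassX3M.exists_padicVal_shaOrder_add_le_three_noMilne V W
    (Wuthrich2014.thm16_charIdeal_dvd_nonsplitMultiplicative_cyclotomicThree_of_cyclotomicPrime hWns)
    (Wuthrich2014.thm16_charIdeal_dvd_splitMultiplicative_cyclotomicThree_of_cyclotomicPrime hWs)
    hGrns hGrs hGS hGZK hmod hmodD hX C hC hrV hrW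

/-- **X3♯(M) at `p = 3`: `BSD(W,3) ∧ BSD(V,3)` on the doubly-unit rank-`(0,0)` rows** —
`ClassX3M.bsdp_three_of_shaAn_units_noMilne` re-based on the odd-`p` multiplicative Wuthrich readings (A126,
A127). Labels UNCHANGED; nothing booked.
[cite: Wuthrich2014, Thm. 16 (p. 397)] [cite: GreenbergLNM1716, §4 pp. 112–113] [cite: Miller2011LMS, §1 and Def. 1.1] -/
theorem ClassX3M.bsdp_three_of_shaAn_units_of_primeFacts_noMilne
    (hWns : Wuthrich2014.thm16_charIdeal_dvd_nonsplitMultiplicative_cyclotomicPrime)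
    (hWs : Wuthrich2014.thm16_charIdeal_dvd_splitMultiplicative_cyclotomicPrime)
    (hGrns : Greenberg1999.thm41Analogue_charValue_rankZero_numberField)
    (hGrs : Greenberg1999.thm41Analogue_charValue_rankZero_split_baseChange)
    (hGS : greenberg_stevens V 3)
    (hGZK : rank_eq_analyticRank_of_analyticRank_le_one) (hmod : hasEntireLFunction_rat)
    (hmodD : nonempty_modularParametrizationData)
    (hX : ClassX3M W 3) (C : VariableChange ℚ) (hC : C • V.quadraticTwist (-(3 : ℚ)) = W)
    (hrV : V.analyticRank = 0) (hrW : W.analyticRank = 0)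
    {qV qW : ℚ} (hqV : shaAn V = (qV : ℂ)) (hqW : shaAn W = (qW : ℂ))
    (hvV : padicValRat 3 qV = 0) (hvW : padicValRat 3 qW = 0) : BSDp W 3 ∧ BSDp V 3 :=
  ClassX3M.bsdp_three_of_shaAn_units_noMilne V W
    (Wuthrich2014.thm16_charIdeal_dvd_nonsplitMultiplicative_cyclotomicThree_of_cyclotomicPrime hWns)
    (Wuthrich2014.thm16_charIdeal_dvd_splitMultiplicative_cyclotomicThree_of_cyclotomicPrime hWs)
    hGrns hGrs hGS hGZK hmod hmodD hX C hC hrV hrW hqV hqW hvV hvW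

/-! ### X4 (irreducible `W[3]`, `surj(3) ∧ ram(3)`): Kato-side readings at a general odd `p` -/

/-- **X4 at `p = 3`, class level, ranks `(0,0)`, ordinary-semistable twist: the sum inequality** —
`ClassX4.exists_padicVal_shaOrder_add_le_three_of_ordSemistableTwist_noMilne` with Kato Thm. 17.4 (3) and the
Wuthrich Thm. 3 / Cor. 19 attributions taken at a GENERAL odd `p` over `ℚ(ζ_p)` (A118, A128, A129) and
specialised to `p = 3` by the kernel bridges of gen 11.
[cite: Kato2004Asterisque, Thm. 17.4 (3) (p. 273)] [cite: Wuthrich2014, Thm. 3 (p. 383) and Cor. 19 (pp. 398–399)]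
[cite: GreenbergLNM1716, Thm. 4.1 (p. 102) and §4 pp. 112–113] [cite: Milne1972ArithmeticAV, §1 Thm. 1 and §2 (through DokchitserDokchitserAnnals2010, §2.1, proof of Thm. 8)] -/
theorem ClassX4.exists_padicVal_shaOrder_add_le_three_of_ordSemistableTwist_of_primeFacts_noMilne
    (hK : Kato2004.charIdeal_dvd_padicLFunction_cyclotomicPrime_of_surjective)
    (hKns : Wuthrich2014.kato_charIdeal_dvd_nonsplitMultiplicative_cyclotomicPrime_of_surjective)
    (hKs : Wuthrich2014.kato_charIdeal_dvd_splitMultiplicative_cyclotomicPrime_of_surjective)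
    (hGr : Greenberg1999.thm41_charValue_rankZero_numberField)
    (hGrns : Greenberg1999.thm41Analogue_charValue_rankZero_numberField)
    (hGrs : Greenberg1999.thm41Analogue_charValue_rankZero_split_baseChange)
    (hGS : greenberg_stevens V 3)
    (hGZK : rank_eq_analyticRank_of_analyticRank_le_one) (hmod : hasEntireLFunction_rat)
    (hmodD : nonempty_modularParametrizationData)
    (hX : ClassX4 W 3) (hsurj : Surj W 3) (hram : Ram W 3)
    (C : VariableChange ℚ) (hC : C • V.quadraticTwist (-(3 : ℚ)) = W)
    (hsst : IsOrdinaryAt V 3 ∨ V.HasMultiplicativeReductionAtPrime 3)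
    (hrV : V.analyticRank = 0) (hrW : W.analyticRank = 0) :
    ∃ qV qW : ℚ, shaAn V = (qV : ℂ) ∧ shaAn W = (qW : ℂ) ∧
      (padicValNat 3 V.shaOrder : ℤ) + padicValNat 3 W.shaOrder ≤ padicValRat 3 qV + padicValRat 3 qW :=
  ClassX4.exists_padicVal_shaOrder_add_le_three_of_ordSemistableTwist_noMilne V W
    (Kato2004.charIdeal_dvd_padicLFunction_cyclotomicThree_of_surjective_of_cyclotomicPrime hK)
    (Wuthrich2014.kato_charIdeal_dvd_nonsplitMultiplicative_cyclotomicThree_of_surjective_of_cyclotomicPrime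
      hKns)
    (Wuthrich2014.kato_charIdeal_dvd_splitMultiplicative_cyclotomicThree_of_surjective_of_cyclotomicPrime
      hKs)
    hGr hGrns hGrs hGS hGZK hmod hmodD hX hsurj hram C hC hsst hrV hrW

/-- **X4 at `p = 3`, class level: the typed UPPER half `Typed.MissingUpperBoundAt W 3`** on the rows
with `3 ∤ #Ш_an(V)` — `ClassX4.missingUpperBoundAt_three_of_ordSemistableTwist_noMilne` re-based on the odd-`p`
Kato-side readings (A118, A128, A129).
[cite: Kato2004Asterisque, Thm. 17.4 (3) (p. 273)] [cite: Wuthrich2014, Thm. 3 (p. 383) and Cor. 19 (pp. 398–399)]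
[cite: GreenbergLNM1716, Thm. 4.1 (p. 102) and §4 pp. 112–113] -/
theorem ClassX4.missingUpperBoundAt_three_of_ordSemistableTwist_of_primeFacts_noMilne
    (hK : Kato2004.charIdeal_dvd_padicLFunction_cyclotomicPrime_of_surjective)
    (hKns : Wuthrich2014.kato_charIdeal_dvd_nonsplitMultiplicative_cyclotomicPrime_of_surjective)
    (hKs : Wuthrich2014.kato_charIdeal_dvd_splitMultiplicative_cyclotomicPrime_of_surjective)
    (hGr : Greenberg1999.thm41_charValue_rankZero_numberField)
    (hGrns : Greenberg1999.thm41Analogue_charValue_rankZero_numberField)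
    (hGrs : Greenberg1999.thm41Analogue_charValue_rankZero_split_baseChange)
    (hGS : greenberg_stevens V 3)
    (hGZK : rank_eq_analyticRank_of_analyticRank_le_one) (hmod : hasEntireLFunction_rat)
    (hmodD : nonempty_modularParametrizationData)
    (hX : ClassX4 W 3) (hsurj : Surj W 3) (hram : Ram W 3)
    (C : VariableChange ℚ) (hC : C • V.quadraticTwist (-(3 : ℚ)) = W)
    (hsst : IsOrdinaryAt V 3 ∨ V.HasMultiplicativeReductionAtPrime 3)
    (hrV : V.analyticRank = 0) (hrW : W.analyticRank = 0)
    {qV : ℚ} (hqV : shaAn V = (qV : ℂ)) (hv : padicValRat 3 qV ≤ 0) :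
    MissingUpperBoundAt W 3 :=
  ClassX4.missingUpperBoundAt_three_of_ordSemistableTwist_noMilne V W
    (Kato2004.charIdeal_dvd_padicLFunction_cyclotomicThree_of_surjective_of_cyclotomicPrime hK)
    (Wuthrich2014.kato_charIdeal_dvd_nonsplitMultiplicative_cyclotomicThree_of_surjective_of_cyclotomicPrime
      hKns)
    (Wuthrich2014.kato_charIdeal_dvd_splitMultiplicative_cyclotomicThree_of_surjective_of_cyclotomicPrime
      hKs)
    hGr hGrns hGrs hGS hGZK hmod hmodD hX hsurj hram C hC hsst hrV hrW hqV hv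

/-- **X4 at `p = 3`, class level: `BSD(W,3) ∧ BSD(V,3)` on the doubly-unit rank-`(0,0)` rows with
`surj(3) ∧ ram(3)`** — `ClassX4.bsdp_three_of_ordSemistableTwist_of_shaAn_units_noMilne` re-based on the odd-`p`
Kato-side readings (A118, A128, A129). Census unchanged (hyp cyc3 two-engine, `N < 2·10⁴`). Labels
UNCHANGED; nothing booked.
[cite: Kato2004Asterisque, Thm. 17.4 (3) (p. 273)] [cite: Wuthrich2014, Thm. 3 (p. 383) and Cor. 19 (pp. 398–399)]
[cite: GreenbergLNM1716, Thm. 4.1 (p. 102) and §4 pp. 112–113] [cite: Miller2011LMS, §1 and Def. 1.1] -/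
theorem ClassX4.bsdp_three_of_ordSemistableTwist_of_shaAn_units_of_primeFacts_noMilne
    (hK : Kato2004.charIdeal_dvd_padicLFunction_cyclotomicPrime_of_surjective)
    (hKns : Wuthrich2014.kato_charIdeal_dvd_nonsplitMultiplicative_cyclotomicPrime_of_surjective)
    (hKs : Wuthrich2014.kato_charIdeal_dvd_splitMultiplicative_cyclotomicPrime_of_surjective)
    (hGr : Greenberg1999.thm41_charValue_rankZero_numberField)
    (hGrns : Greenberg1999.thm41Analogue_charValue_rankZero_numberField)
    (hGrs : Greenberg1999.thm41Analogue_charValue_rankZero_split_baseChange)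
    (hGS : greenberg_stevens V 3)
    (hGZK : rank_eq_analyticRank_of_analyticRank_le_one) (hmod : hasEntireLFunction_rat)
    (hmodD : nonempty_modularParametrizationData)
    (hX : ClassX4 W 3) (hsurj : Surj W 3) (hram : Ram W 3)
    (C : VariableChange ℚ) (hC : C • V.quadraticTwist (-(3 : ℚ)) = W)
    (hsst : IsOrdinaryAt V 3 ∨ V.HasMultiplicativeReductionAtPrime 3)
    (hrV : V.analyticRank = 0) (hrW : W.analyticRank = 0)
    {qV qW : ℚ} (hqV : shaAn V = (qV : ℂ)) (hqW : shaAn W = (qW : ℂ))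
    (hvV : padicValRat 3 qV = 0) (hvW : padicValRat 3 qW = 0) : BSDp W 3 ∧ BSDp V 3 :=
  ClassX4.bsdp_three_of_ordSemistableTwist_of_shaAn_units_noMilne V W
    (Kato2004.charIdeal_dvd_padicLFunction_cyclotomicThree_of_surjective_of_cyclotomicPrime hK)
    (Wuthrich2014.kato_charIdeal_dvd_nonsplitMultiplicative_cyclotomicThree_of_surjective_of_cyclotomicPrime
      hKns)
    (Wuthrich2014.kato_charIdeal_dvd_splitMultiplicative_cyclotomicThree_of_surjective_of_cyclotomicPrime
      hKs)
    hGr hGrns hGrs hGS hGZK hmod hmodD hX hsurj hram C hC hsst hrV hrW hqV hqW hvV hvW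

/-- **X4(M) at `p = 3`, ranks `(0,0)`: the sum inequality** — `ClassX4M.exists_padicVal_shaOrder_add_le_three_noMilne`
re-based on the odd-`p` surjective-multiplicative readings (A128, A129).
[cite: Wuthrich2014, Thm. 3 (p. 383) and Cor. 19 (pp. 398–399)] [cite: GreenbergLNM1716, §4 pp. 112–113]
[cite: SilvermanATAEC1994, V.5.3] -/
theorem ClassX4M.exists_padicVal_shaOrder_add_le_three_of_primeFacts_noMilne
    (hKns : Wuthrich2014.kato_charIdeal_dvd_nonsplitMultiplicative_cyclotomicPrime_of_surjective)
    (hKs : Wuthrich2014.kato_charIdeal_dvd_splitMultiplicative_cyclotomicPrime_of_surjective)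
    (hGrns : Greenberg1999.thm41Analogue_charValue_rankZero_numberField)
    (hGrs : Greenberg1999.thm41Analogue_charValue_rankZero_split_baseChange)
    (hGS : greenberg_stevens V 3)
    (hGZK : rank_eq_analyticRank_of_analyticRank_le_one) (hmod : hasEntireLFunction_rat)
    (hmodD : nonempty_modularParametrizationData)
    (hX : ClassX4M W 3) (hsurj : Surj W 3) (hram : Ram W 3)
    (C : VariableChange ℚ) (hC : C • V.quadraticTwist (-(3 : ℚ)) = W)
    (hrV : V.analyticRank = 0) (hrW : W.analyticRank = 0) :
    ∃ qV qW : ℚ, shaAn V = (qV : ℂ) ∧ shaAn W = (qW : ℂ) ∧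
      (padicValNat 3 V.shaOrder : ℤ) + padicValNat 3 W.shaOrder ≤ padicValRat 3 qV + padicValRat 3 qW :=
  ClassX4M.exists_padicVal_shaOrder_add_le_three_noMilne V W
    (Wuthrich2014.kato_charIdeal_dvd_nonsplitMultiplicative_cyclotomicThree_of_surjective_of_cyclotomicPrime
      hKns)
    (Wuthrich2014.kato_charIdeal_dvd_splitMultiplicative_cyclotomicThree_of_surjective_of_cyclotomicPrime
      hKs)
    hGrns hGrs hGS hGZK hmod hmodD hX hsurj hram C hC hrV hrW

/-- **X4(M) at `p = 3`: `BSD(W,3) ∧ BSD(V,3)` on the doubly-unit rank-`(0,0)` rows with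
`surj(3) ∧ ram(3)`** — `ClassX4M.bsdp_three_of_shaAn_units_noMilne` re-based on the odd-`p`
surjective-multiplicative readings (A128, A129). Labels UNCHANGED; nothing booked.
[cite: Wuthrich2014, Thm. 3 (p. 383) and Cor. 19 (pp. 398–399)] [cite: GreenbergLNM1716, §4 pp. 112–113]
[cite: Miller2011LMS, §1 and Def. 1.1] -/
theorem ClassX4M.bsdp_three_of_shaAn_units_of_primeFacts_noMilne
    (hKns : Wuthrich2014.kato_charIdeal_dvd_nonsplitMultiplicative_cyclotomicPrime_of_surjective)
    (hKs : Wuthrich2014.kato_charIdeal_dvd_splitMultiplicative_cyclotomicPrime_of_surjective)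
    (hGrns : Greenberg1999.thm41Analogue_charValue_rankZero_numberField)
    (hGrs : Greenberg1999.thm41Analogue_charValue_rankZero_split_baseChange)
    (hGS : greenberg_stevens V 3)
    (hGZK : rank_eq_analyticRank_of_analyticRank_le_one) (hmod : hasEntireLFunction_rat)
    (hmodD : nonempty_modularParametrizationData)
    (hX : ClassX4M W 3) (hsurj : Surj W 3) (hram : Ram W 3)
    (C : VariableChange ℚ) (hC : C • V.quadraticTwist (-(3 : ℚ)) = W)
    (hrV : V.analyticRank = 0) (hrW : W.analyticRank = 0)
    {qV qW : ℚ} (hqV : shaAn V = (qV : ℂ)) (hqW : shaAn W = (qW : ℂ))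
    (hvV : padicValRat 3 qV = 0) (hvW : padicValRat 3 qW = 0) : BSDp W 3 ∧ BSDp V 3 :=
  ClassX4M.bsdp_three_of_shaAn_units_noMilne V W
    (Wuthrich2014.kato_charIdeal_dvd_nonsplitMultiplicative_cyclotomicThree_of_surjective_of_cyclotomicPrime
      hKns)
    (Wuthrich2014.kato_charIdeal_dvd_splitMultiplicative_cyclotomicThree_of_surjective_of_cyclotomicPrime
      hKs)
    hGrns hGrs hGS hGZK hmod hmodD hX hsurj hram C hC hrV hrW hqV hqW hvV hvW

end Summit.BirchSwinnertonDyer.Rank1Residual.Additive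

end
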